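import Mathlib
import Literature.MathematicalPhysics.QuantumFieldTheory.OSReconstructionNoE1Proofs
import Summits.QuantumFields.YangMills.Theorems.MirrorModularBoostsPlanarSpectralConeComplexTimeSlot
import HarnessLib

/-!
# One-gap stretching: complex-time matrix elements `⟪ψ, e^{-τH} ψ'⟫` and continuity of field vectors

Crux `MirrorModularBoosts.PlanarSpectralCone` (stmt-QuantumFields-9664), line
`positivity-disc-to-operator-cone`, stub `stub_oneGap` (density half), PART B: the slot functions.

On the OS Hilbert space `h` of a labelled family on `ℝ⁴` with E2 + translations on `⁰𝒮`
(`OSReconstructionNoE1`), the matrix elements `x ↦ ⟪ψ, e^{-xH} ψ'⟫` (`x > 0`) are restrictions of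
functions holomorphic on the right half-plane. Without introducing a definition we prove:

* `eqOn_rightHalfPlane_of_eqOn_pos` — uniqueness: two holomorphic functions on `{Re τ > 0}` with
  the same values on `(0,∞)` coincide (identity theorem);
* `exists_holo_inner_transfer` — existence with the polarisation bound `‖ψ‖² + ‖ψ'‖²` (four joint
  spectral measures, `exists_isJointSpectralMeasure_holds`, and the landed Laplace–Fourier lemma
  `ComplexTimeSlot.exists_laplaceFourier` of the first lead's front end);
* `norm_holo_inner_transfer_le` — the product bound `2‖ψ‖‖ψ'‖` for ANY such function, by the
  scaling `(ψ, ψ') ↦ (λψ, λ⁻¹ψ')` which does not change the real values, plus uniqueness;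
  hence Lipschitz dependence on the vectors (`norm_holo_inner_transfer_sub_le`);
* `tendsto_fieldVec` — continuity of `F ↦ Ψ_F` along time-ordered families (`Ψ_{F-G} = Ψ_F − Ψ_G`
  in `ℋ`, `‖Ψ_F‖² = Re 𝔖(ΘF* ⊗ F)`; adapted from the drefuter's crux workfile
  `Cruxes/PlanarSpectralCone/DrefuteG4DensityAPI.lean`).

References: Osterwalder–Schrader, CMP 31 (1973) §4.1; CMP 42 (1975) Ch. V (5.4). No definitions.
-/

noncomputable section

namespace Summit.QuantumFields.YangMills.Cruxes.PlanarSpectralCone.PositivityDiscToOperatorCone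

open MeasureTheory Complex Set Filter
open scoped InnerProductSpace SchwartzMap ComplexConjugate Topology
open Literature.MathematicalPhysics.QuantumLattice Literature.MathematicalPhysics.AQFT
  Literature.MathematicalPhysics.QuantumFieldTheory

namespace OneGap

/-! ### Uniqueness on the right half-plane -/

/-- The real sequence `x₀ + 1/(n+1)` tends to `x₀` within the punctured neighbourhood. -/
theorem tendsto_ofReal_add_inv_nhdsWithin (x₀ : ℝ) :
    Tendsto (fun n : ℕ => ((x₀ + 1 / ((n : ℝ) + 1) : ℝ) : ℂ)) atTop (𝓝[≠] (x₀ : ℂ)) := by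
  refine tendsto_nhdsWithin_iff.2 ⟨?_, Eventually.of_forall fun n => ?_⟩
  · have h1 : Tendsto (fun n : ℕ => x₀ + 1 / ((n : ℝ) + 1)) atTop (𝓝 x₀) := by
      simpa using (tendsto_const_nhds (x := x₀)).add tendsto_one_div_add_atTop_nhds_zero_nat
    exact (Complex.continuous_ofReal.tendsto x₀).comp h1
  · have hpos : (0 : ℝ) < 1 / ((n : ℝ) + 1) := by positivity
    simp only [mem_compl_iff, mem_singleton_iff, Complex.ofReal_inj]
    linarith

/-- **Identity theorem on the right half-plane from the positive reals**: two functions holomorphic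
on `{Re τ > 0}` which agree at every real `x > 0` agree on the half-plane. -/
theorem eqOn_rightHalfPlane_of_eqOn_pos {f g : ℂ → ℂ} (hf : DifferentiableOn ℂ f {τ : ℂ | 0 < τ.re})
    (hg : DifferentiableOn ℂ g {τ : ℂ | 0 < τ.re}) (hfg : ∀ x : ℝ, 0 < x → f x = g x) :
    EqOn f g {τ : ℂ | 0 < τ.re} := by
  have hU : IsOpen {τ : ℂ | 0 < τ.re} := isOpen_lt continuous_const Complex.continuous_re
  have hconv : Convex ℝ {τ : ℂ | 0 < τ.re} := convex_halfSpace_re_gt 0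
  refine (hf.analyticOnNhd hU).eqOn_of_preconnected_of_frequently_eq (hg.analyticOnNhd hU)
    hconv.isPreconnected (z₀ := ((1 : ℝ) : ℂ)) (by simp) ?_
  refine (tendsto_ofReal_add_inv_nhdsWithin 1).frequently (Eventually.of_forall fun n => ?_).frequently
  exact hfg _ (by positivity)

/-! ### Existence with the polarisation bound -/

/-- The diagonal complex-time function of one vector: `τ ↦ ∫ e^{-τp₀} dμ_χ` is holomorphic on the right
half-plane, bounded by `‖χ‖²`, with real values `⟪χ, e^{-xH} χ⟫`. -/
theorem exists_holo_inner_transfer_self {ι : Type} {T : LabelledSchwingerFamily ι (EuclideanSpace ℝ (Fin 4))}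
    (h : OSReconstructionNoE1 T) (χ : h.Hilbert) :
    ∃ D : ℂ → ℂ, DifferentiableOn ℂ D {τ : ℂ | 0 < τ.re} ∧
      (∀ τ : ℂ, 0 < τ.re → ‖D τ‖ ≤ ‖χ‖ ^ 2) ∧
      ∀ x : ℝ, 0 < x → D x = ⟪χ, h.transfer x χ⟫_ℂ := by
  obtain ⟨μ, hμ⟩ := OSReconstructionNoE1.exists_isJointSpectralMeasure_holds h χ
  haveI := hμ.isFiniteMeasure
  obtain ⟨g, hd, -, hb, hr⟩ := TwoMirrorLightconeSlots.ComplexTimeSlot.exists_laplaceFourier μ hμ.energy_nonneg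
  refine ⟨g 0, hd 0, fun τ hτ => ?_, fun x hx => ?_⟩
  · rw [← hμ.measureReal_univ]; exact hb 0 τ hτ
  · rw [hr 0 x hx, ← hμ.inner_transfer_translate x hx.le 0 rfl, h.translate_zero_apply]

/-- **Complex-time matrix elements exist**: for `ψ, ψ'` there is `φ` holomorphic on `{Re τ > 0}` with
`φ x = ⟪ψ, e^{-xH} ψ'⟫` (`x > 0`) and `‖φ τ‖ ≤ ‖ψ‖² + ‖ψ'‖²` (polarisation over `ψ + iᵏψ'`). -/
theorem exists_holo_inner_transfer {ι : Type} {T : LabelledSchwingerFamily ι (EuclideanSpace ℝ (Fin 4))}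
    (h : OSReconstructionNoE1 T) (ψ ψ' : h.Hilbert) :
    ∃ φ : ℂ → ℂ, DifferentiableOn ℂ φ {τ : ℂ | 0 < τ.re} ∧
      (∀ x : ℝ, 0 < x → φ x = ⟪ψ, h.transfer x ψ'⟫_ℂ) ∧
      ∀ τ : ℂ, 0 < τ.re → ‖φ τ‖ ≤ ‖ψ‖ ^ 2 + ‖ψ'‖ ^ 2 := by
  obtain ⟨D₁, hd₁, hb₁, hr₁⟩ := exists_holo_inner_transfer_self h (ψ + ψ')
  obtain ⟨D₂, hd₂, hb₂, hr₂⟩ := exists_holo_inner_transfer_self h (ψ - ψ')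
  obtain ⟨D₃, hd₃, hb₃, hr₃⟩ := exists_holo_inner_transfer_self h (ψ + I • ψ')
  obtain ⟨D₄, hd₄, hb₄, hr₄⟩ := exists_holo_inner_transfer_self h (ψ - I • ψ')
  refine ⟨fun τ => (D₁ τ - D₂ τ - I * D₃ τ + I * D₄ τ) / 4, ?_, fun x hx => ?_, fun τ hτ => ?_⟩
  · exact (((hd₁.sub hd₂).sub (hd₃.const_mul I)).add (hd₄.const_mul I)).div_const 4
  · show (D₁ x - D₂ x - I * D₃ x + I * D₄ x) / 4 = _
    rw [hr₁ x hx, hr₂ x hx, hr₃ x hx, hr₄ x hx]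
    have := TwoMirrorLightconeSlots.ComplexTimeSlot.inner_transfer_translate_polarization h x 0 ψ ψ'
    simp only [h.translate_zero_apply] at this
    exact this.symm
  · refine (TwoMirrorLightconeSlots.ComplexTimeSlot.norm_polarComb_le (hb₁ τ hτ) (hb₂ τ hτ) (hb₃ τ hτ)
      (hb₄ τ hτ)).trans (le_of_eq ?_)
    have h1 := parallelogram_law_with_norm ℂ ψ ψ'
    have h2 := parallelogram_law_with_norm ℂ ψ (I • ψ')
    rw [norm_smul, Complex.norm_I, one_mul] at h2
    nlinarith [h1, h2]

/-! ### The product bound by scaling, and Lipschitz dependence on the vectors -/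

/-- **Product bound**: ANY function holomorphic on `{Re τ > 0}` whose values at real `x > 0` are
`⟪ψ, e^{-xH} ψ'⟫` satisfies `‖φ τ‖ ≤ 2‖ψ‖‖ψ'‖` there. Proof: the pair `(λψ, λ⁻¹ψ')` (`λ > 0`) has the
same real values, so by uniqueness `‖φ τ‖ ≤ λ²‖ψ‖² + λ⁻²‖ψ'‖²` for every `λ > 0`. -/
theorem norm_holo_inner_transfer_le {ι : Type} {T : LabelledSchwingerFamily ι (EuclideanSpace ℝ (Fin 4))}
    (h : OSReconstructionNoE1 T) (ψ ψ' : h.Hilbert) {φ : ℂ → ℂ}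
    (hφ : DifferentiableOn ℂ φ {τ : ℂ | 0 < τ.re}) (hφr : ∀ x : ℝ, 0 < x → φ x = ⟪ψ, h.transfer x ψ'⟫_ℂ)
    {τ : ℂ} (hτ : 0 < τ.re) :
    ‖φ τ‖ ≤ 2 * ‖ψ‖ * ‖ψ'‖ := by
  -- the scaled bound for every `t > 0`
  have key : ∀ t : ℝ, 0 < t → ‖φ τ‖ ≤ t ^ 2 * ‖ψ‖ ^ 2 + (t ^ 2)⁻¹ * ‖ψ'‖ ^ 2 := by
    intro t ht
    obtain ⟨φ', hφ'd, hφ'r, hφ'b⟩ := exists_holo_inner_transfer h ((t : ℂ) • ψ) (((t : ℂ))⁻¹ • ψ')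
    have heq : EqOn φ φ' {τ : ℂ | 0 < τ.re} := by
      refine eqOn_rightHalfPlane_of_eqOn_pos hφ hφ'd fun x hx => ?_
      rw [hφr x hx, hφ'r x hx, map_smul, inner_smul_left, inner_smul_right, Complex.conj_ofReal,
        ← mul_assoc, mul_inv_cancel₀ (by exact_mod_cast ht.ne'), one_mul]
    rw [heq hτ]
    refine (hφ'b τ hτ).trans (le_of_eq ?_)
    rw [norm_smul, norm_smul, norm_inv, Complex.norm_real, Real.norm_of_nonneg ht.le]
    ring
  -- optimise over `t`
  refine le_of_forall_pos_le_add fun ε hε => ?_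
  set a : ℝ := ‖ψ‖ with ha
  set b : ℝ := ‖ψ'‖ with hb
  have ha0 : 0 ≤ a := norm_nonneg _
  have hb0 : 0 ≤ b := norm_nonneg _
  set δ : ℝ := ε / (a + b + 1) with hδ
  have hδ0 : 0 < δ := by positivity
  have hδ1 : δ * (a + b) ≤ ε := by
    rw [hδ, div_mul_eq_mul_div, div_le_iff₀ (by positivity)]
    nlinarith
  -- `t² = (b + δ)/(a + δ)`
  set q : ℝ := (b + δ) / (a + δ) with hq
  have hq0 : 0 < q := by positivity
  have h1 := key (Real.sqrt q) (Real.sqrt_pos.2 hq0)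
  rw [Real.sq_sqrt hq0.le] at h1
  have hqa : q * a ^ 2 ≤ a * (b + δ) := by
    rw [hq, div_mul_eq_mul_div, div_le_iff₀ (by positivity)]
    nlinarith [mul_nonneg (mul_nonneg ha0 (by positivity : (0 : ℝ) ≤ b + δ)) hδ0.le]
  have hqb : q⁻¹ * b ^ 2 ≤ b * (a + δ) := by
    rw [hq, inv_div, div_mul_eq_mul_div, div_le_iff₀ (by positivity)]
    nlinarith [mul_nonneg (mul_nonneg hb0 (by positivity : (0 : ℝ) ≤ a + δ)) hδ0.le]
  calc ‖φ τ‖ ≤ q * a ^ 2 + q⁻¹ * b ^ 2 := h1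
    _ ≤ a * (b + δ) + b * (a + δ) := add_le_add hqa hqb
    _ = 2 * a * b + δ * (a + b) := by ring
    _ ≤ 2 * a * b + ε := by linarith

/-- **Lipschitz dependence on the second vector**: two such functions for `(ψ, ψ₁)` and `(ψ, ψ₂)`
differ by at most `2‖ψ‖‖ψ₁ − ψ₂‖` on the half-plane. -/
theorem norm_holo_inner_transfer_sub_right_le {ι : Type}
    {T : LabelledSchwingerFamily ι (EuclideanSpace ℝ (Fin 4))} (h : OSReconstructionNoE1 T)
    (ψ ψ₁ ψ₂ : h.Hilbert) {φ₁ φ₂ : ℂ → ℂ}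
    (hφ₁ : DifferentiableOn ℂ φ₁ {τ : ℂ | 0 < τ.re}) (hφ₂ : DifferentiableOn ℂ φ₂ {τ : ℂ | 0 < τ.re})
    (h₁ : ∀ x : ℝ, 0 < x → φ₁ x = ⟪ψ, h.transfer x ψ₁⟫_ℂ) (h₂ : ∀ x : ℝ, 0 < x → φ₂ x = ⟪ψ, h.transfer x ψ₂⟫_ℂ)
    {τ : ℂ} (hτ : 0 < τ.re) :
    ‖φ₁ τ - φ₂ τ‖ ≤ 2 * ‖ψ‖ * ‖ψ₁ - ψ₂‖ :=
  norm_holo_inner_transfer_le h ψ (ψ₁ - ψ₂) (hφ₁.sub hφ₂)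
    (fun x hx => by simp only [Pi.sub_apply, h₁ x hx, h₂ x hx, map_sub, inner_sub_right]) hτ

/-- **Lipschitz dependence on the first vector**: two such functions for `(ψ₁, ψ')` and `(ψ₂, ψ')`
differ by at most `2‖ψ₁ − ψ₂‖‖ψ'‖` on the half-plane. -/
theorem norm_holo_inner_transfer_sub_left_le {ι : Type}
    {T : LabelledSchwingerFamily ι (EuclideanSpace ℝ (Fin 4))} (h : OSReconstructionNoE1 T)
    (ψ₁ ψ₂ ψ' : h.Hilbert) {φ₁ φ₂ : ℂ → ℂ}
    (hφ₁ : DifferentiableOn ℂ φ₁ {τ : ℂ | 0 < τ.re}) (hφ₂ : DifferentiableOn ℂ φ₂ {τ : ℂ | 0 < τ.re})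
    (h₁ : ∀ x : ℝ, 0 < x → φ₁ x = ⟪ψ₁, h.transfer x ψ'⟫_ℂ) (h₂ : ∀ x : ℝ, 0 < x → φ₂ x = ⟪ψ₂, h.transfer x ψ'⟫_ℂ)
    {τ : ℂ} (hτ : 0 < τ.re) :
    ‖φ₁ τ - φ₂ τ‖ ≤ 2 * ‖ψ₁ - ψ₂‖ * ‖ψ'‖ :=
  norm_holo_inner_transfer_le h (ψ₁ - ψ₂) ψ' (hφ₁.sub hφ₂)
    (fun x hx => by simp only [Pi.sub_apply, h₁ x hx, h₂ x hx, inner_sub_left]) hτ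

/-! ### Continuity of `F ↦ Ψ_F` along time-ordered families -/

section FieldVec

variable {ι : Type*} {d : ℕ} [NeZero d] {S : LabelledSchwingerFamily ι (EuclideanSpace ℝ (Fin d))}
  (h : OSReconstructionNoE1 S)

-- adapted from Cruxes/PlanarSpectralCone/DrefuteG4DensityAPI.lean (drefuter gen 4)

/-- Sums of time-ordered test functions are time-ordered. -/
theorem isTimeOrdered_add {n : ℕ} {F G : 𝓢((Fin n → EuclideanSpace ℝ (Fin d)), ℂ)}
    (hF : IsTimeOrdered F) (hG : IsTimeOrdered G) : IsTimeOrdered (F + G) := by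
  intro x hx
  have hsub : tsupport ((F + G : 𝓢((Fin n → EuclideanSpace ℝ (Fin d)), ℂ)) :
      (Fin n → EuclideanSpace ℝ (Fin d)) → ℂ) ⊆
      tsupport (F : (Fin n → EuclideanSpace ℝ (Fin d)) → ℂ) ∪
        tsupport (G : (Fin n → EuclideanSpace ℝ (Fin d)) → ℂ) := by
    rw [tsupport, tsupport, tsupport, ← closure_union]
    refine closure_mono fun y hy => ?_
    by_contra hy'
    simp only [Set.mem_union, Function.mem_support, not_or, not_not] at hy'
    exact hy (by simp [hy'.1, hy'.2])
  rcases hsub hx with hx' | hx'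
  · exact hF hx'
  · exact hG hx'

/-- Differences of time-ordered test functions are time-ordered. -/
theorem isTimeOrdered_sub {n : ℕ} {F G : 𝓢((Fin n → EuclideanSpace ℝ (Fin d)), ℂ)}
    (hF : IsTimeOrdered F) (hG : IsTimeOrdered G) : IsTimeOrdered (F - G) := by
  rw [sub_eq_add_neg]
  refine isTimeOrdered_add hF ?_
  have : (-G : 𝓢((Fin n → EuclideanSpace ℝ (Fin d)), ℂ)) = (-1 : ℂ) • G := by rw [neg_one_smul]
  rw [this]
  exact OSReconstructionNoE1.isTimeOrdered_smul _ hG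

/-- `⟪Ψ_F, Ψ_G⟫ = 𝔖(ΘF* ⊗ G)` with the canonical tensor witness. -/
theorem inner_fieldVec_fieldVec' {n m : ℕ} (k : Fin n → ι) (k' : Fin m → ι)
    {F : 𝓢((Fin n → EuclideanSpace ℝ (Fin d)), ℂ)} {G : 𝓢((Fin m → EuclideanSpace ℝ (Fin d)), ℂ)}
    (hF : IsTimeOrdered F) (hG : IsTimeOrdered G) :
    ⟪h.fieldVec n k F hF, h.fieldVec m k' G hG⟫_ℂ =
      S (n + m) (Fin.append (k ∘ Fin.rev) k') ((osAdjoint F).appendTensor G) :=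
  h.inner_fieldVec_fieldVec k k' hF hG (isAppendTensorOf_appendTensor _ _)

/-- **`Ψ_{F−G} = Ψ_F − Ψ_G`** in `ℋ` (the difference is a null vector of the OS form). -/
theorem fieldVec_sub {n : ℕ} (k : Fin n → ι) {F G : 𝓢((Fin n → EuclideanSpace ℝ (Fin d)), ℂ)}
    (hF : IsTimeOrdered F) (hG : IsTimeOrdered G) (hFG : IsTimeOrdered (F - G)) :
    h.fieldVec n k (F - G) hFG = h.fieldVec n k F hF - h.fieldVec n k G hG := by
  have hs : osAdjoint (F - G) = osAdjoint F - osAdjoint G := by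
    rw [sub_eq_add_neg, Literature.MathematicalPhysics.QuantumLattice.osAdjoint_add, ← neg_one_smul ℂ G,
      Literature.MathematicalPhysics.QuantumLattice.osAdjoint_smul, map_neg, map_one, neg_one_smul,
      ← sub_eq_add_neg]
  rw [← sub_eq_zero, ← inner_self_eq_zero (𝕜 := ℂ)]
  simp only [inner_sub_left, inner_sub_right, inner_fieldVec_fieldVec', map_sub, hs,
    SchwartzMap.appendTensor_sub_left, SchwartzMap.appendTensor_sub_right]
  ring

/-- **`‖Ψ_F‖² = Re 𝔖(ΘF* ⊗ F)`.** -/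
theorem norm_fieldVec_sq {n : ℕ} (k : Fin n → ι) {F : 𝓢((Fin n → EuclideanSpace ℝ (Fin d)), ℂ)}
    (hF : IsTimeOrdered F) :
    ‖h.fieldVec n k F hF‖ ^ 2 = (S (n + n) (Fin.append (k ∘ Fin.rev) k) ((osAdjoint F).appendTensor F)).re := by
  rw [← inner_fieldVec_fieldVec' h k k hF hF, ← inner_self_eq_norm_sq (𝕜 := ℂ)]
  rfl

/-- **Continuity of `F ↦ Ψ_F` along time-ordered families**: if `F a → G` in `𝒮` (all time-ordered)
then `Ψ_{F a} → Ψ_G` in `ℋ`. -/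
theorem tendsto_fieldVec {α : Type*} {l : Filter α} {n : ℕ} (k : Fin n → ι)
    {F : α → 𝓢((Fin n → EuclideanSpace ℝ (Fin d)), ℂ)} (hF : ∀ a, IsTimeOrdered (F a))
    {G : 𝓢((Fin n → EuclideanSpace ℝ (Fin d)), ℂ)} (hG : IsTimeOrdered G)
    (hlim : Tendsto F l (𝓝 G)) :
    Tendsto (fun a => h.fieldVec n k (F a) (hF a)) l (𝓝 (h.fieldVec n k G hG)) := by
  rw [tendsto_iff_norm_sub_tendsto_zero]
  have hq : Continuous fun A : 𝓢((Fin n → EuclideanSpace ℝ (Fin d)), ℂ) =>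
      (S (n + n) (Fin.append (k ∘ Fin.rev) k) ((osAdjoint A).appendTensor A)).re :=
    Complex.continuous_re.comp ((S (n + n) (Fin.append (k ∘ Fin.rev) k)).continuous.comp
      (continuous_appendTensor.comp (continuous_osAdjoint.prodMk continuous_id)))
  have h0 : Tendsto (fun a => F a - G) l (𝓝 0) := by
    have := hlim.sub (tendsto_const_nhds (x := G))
    rwa [sub_self] at this
  have h1 : Tendsto (fun a => (S (n + n) (Fin.append (k ∘ Fin.rev) k)
      ((osAdjoint (F a - G)).appendTensor (F a - G))).re) l (𝓝 0) := by
    have := (hq.tendsto 0).comp h0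
    have hz : (S (n + n) (Fin.append (k ∘ Fin.rev) k)
        ((osAdjoint (0 : 𝓢((Fin n → EuclideanSpace ℝ (Fin d)), ℂ))).appendTensor 0)).re = 0 := by
      have : ((osAdjoint (0 : 𝓢((Fin n → EuclideanSpace ℝ (Fin d)), ℂ))).appendTensor
          (0 : 𝓢((Fin n → EuclideanSpace ℝ (Fin d)), ℂ))) = 0 := by
        ext x; simp
      rw [this, map_zero, Complex.zero_re]
    simpa [Function.comp_def, hz] using this
  have h2 : ∀ a, ‖h.fieldVec n k (F a) (hF a) - h.fieldVec n k G hG‖ =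
      Real.sqrt ((S (n + n) (Fin.append (k ∘ Fin.rev) k)
        ((osAdjoint (F a - G)).appendTensor (F a - G))).re) := by
    intro a
    rw [← fieldVec_sub h k (hF a) hG (isTimeOrdered_sub (hF a) hG), ← norm_fieldVec_sq,
      Real.sqrt_sq (norm_nonneg _)]
  simp_rw [h2]
  have := h1.sqrt
  rwa [Real.sqrt_zero] at this

end FieldVec

end OneGap

end Summit.QuantumFields.YangMills.Cruxes.PlanarSpectralCone.PositivityDiscToOperatorCone
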